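import Literature.NumberTheory.LFunctions.SuzukiSingleOperatorKernel

/-!
# SuzukiCleanRadius — definitions: clean windows of `𝖪_θ[t]` up to a radius, the LINEAR clean radius, the height bound (column DBR; RH-FREE; defs only)

RH-FREE typed statements about Suzuki's single-operator kernel `K_θ = limKernel θ` ([Su20] = M. Suzuki, ASPM 84
(2020) 399–411 = arXiv:1907.07302, (1.9)) and its truncations `𝖪_θ[t]` on `L²(−t,t)` (window predicate
`NoUnitEigenvalue`, tree).  They are the cell rh-dbr's BANKED targets of the idea card `theta-semigroup-clean-radius`
(2026-08-26; ENGINE-TARGETS.md §4.4; referee tautology test PASS, «not Weil/RH re-indexed»), typed here verbatim so that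
the proofs (`Theorems.SuzukiCleanRadius`, `…Leaf`) can cite them by name:
* `CleanUpTo θ T` — every window `0 ≤ t ≤ T` of `𝖪_θ` carries no eigenvalue `±1`;
* `LinearCleanRadius` — `∃ c > 0, ∃ θ₁, ∀ θ ≥ θ₁, CleanUpTo θ (cθ)`: the θ-UNIFORM, explicit-rate form of [Su20] Thm 1.2
  (K-v) (printed: an inexplicit `τ_θ > 0` per `θ`);
* `EventuallyCleanEachWindow` — `∀ T ≥ 0, ∃ θ₀, ∀ θ ≥ θ₀, CleanUpTo θ T`: the RH-free quantifier swap of the residual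
  `Theses.SuzukiWindowsDoor.AllWindowsWitness` (`∃ θ ∀ t`); proved from `LinearCleanRadius` by pure logic here;
* `HeightOptimisedBound` — `|K_θ(x)| ≤ C e^{bx + Aθ} b^{1−θ}` for all `θ ≥ 3`, `b ≥ 3/2`, `x` (inversion line moved to
  `Im z = b`; the `b^{1−θ}` is the `Γ(θ)`-type smallness of order-`θ` integration).
Labels: every statement is RH-FREE (each is trivially implied by RH and carries no RH-specific force: a clean window
certifies nothing about RH; `∃ θ ∀ t` clean is RH by `Theorems.SuzukiWindowsDoorConverse.allWindows_iff_riemannHypothesis`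
and is NOT asserted).  Nothing here bears on the truth of RH.
-/

noncomputable section

-- D-0017: `Summit.<S>.<S>.…` is the designed namespace of a single-problem summit.
set_option linter.dupNamespace false

namespace Summit.RiemannHypothesis.RiemannHypothesis.Theorems.SuzukiCleanRadius

open Literature.NumberTheory.LFunctions

/-- RH-FREE predicate: `𝖪_θ[t]` has no eigenvalue `±1` on `L²(−t,t)` for every window `0 ≤ t ≤ T`
("`K_θ` is clean up to radius `T`"). -/
def CleanUpTo (θ T : ℝ) : Prop :=
  ∀ t : ℝ, 0 ≤ t → t ≤ T → NoUnitEigenvalue (limKernel θ) t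

/-- **RH-FREE target `LinearCleanRadius`**: for all large `θ` every window of length `≤ c·θ` is clean —
`∃ c > 0, ∃ θ₁, ∀ θ ≥ θ₁, CleanUpTo θ (c·θ)`.  ([Su20] Thm 1.2 (K-v) gives an inexplicit `τ_θ > 0` per `θ`; this is
the uniform linear lower bound `τ_θ ≥ cθ`.) -/
def LinearCleanRadius : Prop :=
  ∃ c : ℝ, 0 < c ∧ ∃ θ₁ : ℝ, ∀ θ : ℝ, θ₁ ≤ θ → CleanUpTo θ (c * θ)

/-- **RH-FREE corollary `EventuallyCleanEachWindow`**: the quantifier swap of the residual `AllWindowsWitness`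
(`∃ θ ∀ t` ↦ `∀ T ∃ θ₀ ∀ θ ≥ θ₀`): every fixed window radius `T` is eventually clean along the family `θ → ∞`. -/
def EventuallyCleanEachWindow : Prop :=
  ∀ T : ℝ, 0 ≤ T → ∃ θ₀ : ℝ, ∀ θ : ℝ, θ₀ ≤ θ → CleanUpTo θ T

/-- **RH-FREE target `HeightOptimisedBound`**: moving the inversion line of (1.9) to `Im z = b` gives
`|K_θ(x)| ≤ C · e^{b x + A θ} · b^{1−θ}` for all `b ≥ 3/2`, `θ ≥ 3`, `x ∈ ℝ`, with absolute constants `C > 0`, `A`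
(the choice `b ≍ θ/x` yields `Γ(θ)`-type smallness of `K_θ` on windows `x ≤ cθ`). -/
def HeightOptimisedBound : Prop :=
  ∃ C A : ℝ, 0 < C ∧ ∀ θ : ℝ, 3 ≤ θ → ∀ b : ℝ, 3 / 2 ≤ b → ∀ x : ℝ,
    |limKernel θ x| ≤ C * Real.exp (b * x + A * θ) * b ^ (1 - θ)

/-- Pure logic (RH-free): a linear clean radius makes every fixed window eventually clean
(`θ₀ = max θ₁ (T/c)`). -/
theorem eventuallyCleanEachWindow_of_linearCleanRadius (h : LinearCleanRadius) : EventuallyCleanEachWindow := by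
  obtain ⟨c, hc, θ₁, h⟩ := h
  intro T _hT
  refine ⟨max θ₁ (T / c), fun θ hθ t ht0 htT => h θ (le_trans (le_max_left _ _) hθ) t ht0 ?_⟩
  have hθ' : T / c ≤ θ := le_trans (le_max_right _ _) hθ
  have : T ≤ c * θ := by
    calc T = c * (T / c) := by field_simp
      _ ≤ c * θ := mul_le_mul_of_nonneg_left hθ' hc.le
  linarith

/-- Monotonicity (RH-free): clean up to `T` implies clean up to any `T' ≤ T`. -/
theorem CleanUpTo.mono {θ T T' : ℝ} (h : CleanUpTo θ T) (hle : T' ≤ T) : CleanUpTo θ T' :=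
  fun t ht0 ht => h t ht0 (ht.trans hle)

end Summit.RiemannHypothesis.RiemannHypothesis.Theorems.SuzukiCleanRadius

end
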